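import Literature.AlgebraicGeometry.HodgeTheory.EllipticCurvePowersHodgeClasses
import HarnessLib

/-!
# Typed cup words on products of copies of an elliptic curve: classes of type `(p₀,q₀)` are combinations of
# TYPED letter monomials; normal forms of the monomials of a word by its slot pattern; shears of `E³`

Family `hodge`, layer `Literature/AlgebraicGeometry/HodgeTheory`. Written for the cell `pub-hodgeav-hg6` (LADDER-HodgeAV
row 2, TABLE X row 21 `g6.E3xY3.(2,1)`, census programme γ2, brick γ2-D(ii) «`S`-side», eng-2 g6; honest framing of that cell:
HC / HC_AV / HC_CM NOT proved — THIS file is UNCONDITIONAL Hodge theory / linear algebra). Theorems only (no definition, no named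
fact, D-0026; nothing admitted). It extends the tree's `NonCMEllipticCurvePowersHodgeClasses` (slot structures `EllSlots E B g`,
letters `slotLetters g v (i, ℓ) = g_i^* v_ℓ`, `EllSlots.exists_balanced_wordEval_eq` for the `(p,p)`-classes) from the balanced
case to an ARBITRARY Hodge type `(p₀, q₀)`, and supplies the word-level normal forms used in the codimension-three census of
`T × E³` (Moonen–Zarhin 1999 Thm. 0.2 (1)):

* `AbelianVariety.mem_of_isOfHodgeType_of_typed_mem` — a class of type `(p₀,q₀)` (`p₀ + q₀ = k > 0`) on a complex abelian
  variety lies in any subspace containing the cup monomials `x₁ ⌣ ⋯ ⌣ x_k` of letters of pure types with `p₀` of type `(1,0)`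
  and `q₀` of type `(0,1)` (Lange–Birkenhake Thm. 4.2.1 `H^{p,q} = ⋀ᵖ H^{1,0} ⊗ ⋀^q H^{0,1}`, span form; the type projector of a
  Hodge model kills the monomials of the other types);
* `EllSlots.exists_typed_wordEval_eq` — on `B` with slots over `E` and the Hodge basis `f = (ω, ω̄)` of `H¹(E)`, a class of type
  `(p₀,q₀)` is `Σ_w a(w) · (g f)_w` with `a` supported on the words of colour content `(p₀, q₀)`;
* `exists_perm_eq_comp_of_range_eq`, `map_word_eq_sign_smul_of_bijective_fst`, `map_word_of_slotCounts_two_one` — an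
  alternating map evaluated on a word: words with bijective slot map are `±` the monomial of a COLOUR PATTERN in slot order;
  three-letter words with slot counts `(2, 1)` at `(a, b)` are `0` or `±` the standard word `((a,0), (a,1), (b,r))`;
* `EllipticCurve.powThree_shear_comp_powSlots`, `…_slotLetters` — the shear endomorphism `x_a ↦ x_a + ψ(x_c)` of
  `E³ = E.powSucc 2` and its action on the letters (`(g f)_{(a,r)} ↦ (g f)_{(a,r)} + g_c^*(ψ^* f_r)`, the others fixed);
* `EllipticCurve.slotLetters_cross_mem_span_rational_oneOne_of_not_hodgeEndTrivial` — for `E` WITH complex multiplication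
  (Hodge-theoretically: `¬ HodgeEndTrivial E`) the single cross `g_i^*ω ⌣ g_j^*ω̄` lies in `D¹(B) ⊗ ℂ` (pull-back of the tree's
  `EllipticCurve.cross_mem_span_rational_oneOne_of_not_hodgeEndTrivial` along `(g_i, g_j) : B → E × E`).

## Sources

* [LangeBirkenhake1992] H. Lange, Ch. Birkenhake, *Complex Abelian Varieties* (1992), Lemma 1.1.17, Thm. 4.2.1, §5.
* [Gordon1997] B. B. Gordon, A survey of the Hodge conjecture for abelian varieties, arXiv:alg-geom/9709030, §3.
* [MoonenZarhin1999LowDim] B. Moonen, Yu. Zarhin, Hodge classes on abelian varieties of low dimension, Math. Ann. 315 (1999),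
  Thm. 0.2 (1), §2 (2.1), §5.
* [VoisinHodgeI2002] C. Voisin, *Hodge Theory and Complex Algebraic Geometry I* (2002), §6.1.3, §7.1.1, §11.3.2.
* [FultonYoungTableaux1997] W. Fulton, *Young Tableaux* (1997), §8.1 (words, contents).
-/

noncomputable section

open CategoryTheory
open Literature.AlgebraicTopology.SingularHomology
open Literature.AlgebraicGeometry.Motives (IsSmoothProjective AbelianVariety)
open Literature.Barriers.HodgeConjecture
open Literature.NumberTheory.DiophantineGeometry
open Literature.RepresentationTheory.GeneralLinear

namespace Literature.AlgebraicGeometry.HodgeTheory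

/-! ### §1 Classes of type `(p₀,q₀)` are combinations of typed monomials -/

section Structural

variable (A : AbelianVariety ℂ)

/-- **Every class of Hodge type `(p₀,q₀)` on a complex abelian variety lies in any subspace containing the typed cup monomials**
(`p₀ + q₀ = k ≥ 1`): if `S ⊆ Hᵏ(A(ℂ); ℂ)` contains `x₁ ⌣ ⋯ ⌣ x_k` for all degree-one classes `xᵢ` of pure types
`(pᵢ, qᵢ) ∈ {(1,0),(0,1)}` with `p₀` of the first and `q₀` of the second kind, then `S` contains every class of Hodge type
`(p₀,q₀)` (`Hᵏ = ⋀ᵏ H¹` is spanned by cup monomials; split each factor into its `(1,0)`- and `(0,1)`-parts, expand, and project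
onto the type-`(p₀,q₀)` piece of a Hodge model: the monomials of the other types are killed). The `(p,p)` case is the tree's
`AbelianVariety.mem_of_isOfHodgeType_of_balanced_mem`, whose proof this copies. [cite: LangeBirkenhake1992, Thm. 4.2.1 and Lemma 1.1.17]
[cite: VoisinHodgeI2002, §7.1.1] -/
theorem AbelianVariety.mem_of_isOfHodgeType_of_typed_mem {k p₀ q₀ : ℕ} (hk : 0 < k) (hpq : p₀ + q₀ = k)
    (S : Submodule ℂ (complexBetti A.X k))
    (hS : ∀ (x : Fin k → complexBetti A.X 1) (p' q' : Fin k → ℕ),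
      (∀ i, (p' i = 1 ∧ q' i = 0) ∨ (p' i = 0 ∧ q' i = 1)) →
      (∀ i, IsOfHodgeType A.dim A.X 1 (p' i) (q' i) (x i)) → ∑ i, p' i = p₀ → ∑ i, q' i = q₀ →
        cupPowOne ℂ (Motives.ComplexPoints A.X) k x ∈ S)
    (c : complexBetti A.X k) (hc : IsOfHodgeType A.dim A.X k p₀ q₀ c) : c ∈ S := by
  have hX : IsSmoothProjective A.dim A.X := Motives.AbelianVariety.isSmoothProjective_holds
  have hspan := (Motives.AbelianVariety.hasExteriorCohomologyH1_complexPoints A).span_range_cupPowOne k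
  have hc_top : c ∈ Submodule.span ℂ (Set.range (cupPowOne ℂ (Motives.ComplexPoints A.X) k)) := by
    rw [hspan]; exact Submodule.mem_top
  obtain ⟨M, hM⟩ := id hc
  have hpp : (p₀, q₀) ∈ Finset.HasAntidiagonal.antidiagonal k := by
    rw [Finset.HasAntidiagonal.mem_antidiagonal]; exact hpq
  let pq₀ : ↥(Finset.HasAntidiagonal.antidiagonal k) := ⟨(p₀, q₀), hpp⟩
  have hcP : c ∈ M.typePiece k pq₀ := (M.mem_typePiece_iff pq₀ c).2 (hc.mem_hodgePQ hX M)
  have key : ∀ v : Fin k → complexBetti A.X 1,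
      M.typeProj k pq₀ (cupPowOne ℂ (Motives.ComplexPoints A.X) k v) ∈ S := by
    intro v
    choose a b hab ha hb using fun i ↦ exists_add_eq_of_isOfHodgeType_one hX (v i)
    have hv : v = a + b := funext fun i ↦ (hab i).symm
    rw [hv, MultilinearMap.map_add_univ, map_sum]
    refine Submodule.sum_mem _ fun s _ ↦ ?_
    let p' : Fin k → ℕ := fun i ↦ if i ∈ s then 1 else 0
    let q' : Fin k → ℕ := fun i ↦ if i ∈ s then 0 else 1
    have h01 : ∀ i, (p' i = 1 ∧ q' i = 0) ∨ (p' i = 0 ∧ q' i = 1) := by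
      intro i
      by_cases hi : i ∈ s
      · exact Or.inl ⟨by simp [p', hi], by simp [q', hi]⟩
      · exact Or.inr ⟨by simp [p', hi], by simp [q', hi]⟩
    have hx : ∀ i, IsOfHodgeType A.dim A.X 1 (p' i) (q' i) (s.piecewise a b i) := by
      intro i
      by_cases hi : i ∈ s
      · simpa [p', q', hi] using ha i
      · simpa [p', q', hi] using hb i
    have htype : IsOfHodgeType A.dim A.X k (∑ i, p' i) (∑ i, q' i)
        (cupPowOne ℂ (Motives.ComplexPoints A.X) k (s.piecewise a b)) :=
      isOfHodgeType_cupPowOne hX hk _ p' q' hx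
    have hsum : ∑ i, p' i + ∑ i, q' i = k := by
      rw [← Finset.sum_add_distrib]
      have h1 : ∀ i, p' i + q' i = 1 := by
        intro i
        rcases h01 i with h | h <;> rw [h.1, h.2]
      simp_rw [h1]
      simp
    by_cases hbal : ∑ i, p' i = p₀
    · have hq : ∑ i, q' i = q₀ := by omega
      have hmono : cupPowOne ℂ (Motives.ComplexPoints A.X) k (s.piecewise a b) ∈ S :=
        hS _ p' q' h01 hx hbal hq
      have htype' : IsOfHodgeType A.dim A.X k p₀ q₀
          (cupPowOne ℂ (Motives.ComplexPoints A.X) k (s.piecewise a b)) := by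
        rw [hbal, hq] at htype; exact htype
      have hP : cupPowOne ℂ (Motives.ComplexPoints A.X) k (s.piecewise a b) ∈ M.typePiece k pq₀ :=
        (M.mem_typePiece_iff pq₀ _).2 (htype'.mem_hodgePQ hX M)
      rw [M.typeProj_apply_of_mem hP]
      exact hmono
    · have hmem : (∑ i, p' i, ∑ i, q' i) ∈ Finset.HasAntidiagonal.antidiagonal k := by
        rw [Finset.HasAntidiagonal.mem_antidiagonal]; exact hsum
      let pq₁ : ↥(Finset.HasAntidiagonal.antidiagonal k) := ⟨(∑ i, p' i, ∑ i, q' i), hmem⟩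
      have hP : cupPowOne ℂ (Motives.ComplexPoints A.X) k (s.piecewise a b) ∈ M.typePiece k pq₁ :=
        (M.mem_typePiece_iff pq₁ _).2 (htype.mem_hodgePQ hX M)
      have hne : pq₁ ≠ pq₀ := by
        intro h
        exact hbal (congrArg (fun t : ↥(Finset.HasAntidiagonal.antidiagonal k) ↦ t.1.1) h)
      rw [M.typeProj_apply_of_mem_ne hne hP]
      exact Submodule.zero_mem _
  have hle : Submodule.span ℂ (Set.range (cupPowOne ℂ (Motives.ComplexPoints A.X) k)) ≤
      S.comap (M.typeProj k pq₀) :=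
    Submodule.span_le.2 (by rintro _ ⟨v, rfl⟩; exact key v)
  have h := hle hc_top
  rw [Submodule.mem_comap, M.typeProj_apply_of_mem hcP] at h
  exact h

end Structural

/-! ### §2 Slot structures: classes of type `(p₀,q₀)` are typed words in the letters `g_i^* ω, g_i^* ω̄` -/

section TypedWords

variable {E B : AbelianVariety ℂ} {n : ℕ} {g : Fin n → (B ⟶ E)}

/-- **A class of type `(p₀,q₀)` has a coefficient function supported on the words of colour content `(p₀,q₀)`** in the letters
`g_i^* f₀ = g_i^* ω` (colour `0`, type `(1,0)`) and `g_i^* f₁ = g_i^* ω̄` (colour `1`, type `(0,1)`): `p₀ + q₀ = k ≥ 1`,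
`c = Σ_w a(w) · (g f)_w` with `a(w) ≠ 0` only if `w` has `p₀` letters of colour `0` and `q₀` of colour `1`. (Expand the typed
letters of `AbelianVariety.mem_of_isOfHodgeType_of_typed_mem` in the letters of their colour, `EllSlots.mem_span_slotLetters_zero`
∕ `_one`, multilinearly.) The balanced case is the tree's `EllSlots.exists_balanced_wordEval_eq`.
[cite: LangeBirkenhake1992, Thm. 4.2.1] [cite: Gordon1997, §3] -/
theorem EllSlots.exists_typed_wordEval_eq (hg : EllSlots E B g)
    (f : Module.Basis (Fin 2) ℂ (complexBetti E.X 1)) (hf0 : IsOfHodgeType E.dim E.X 1 1 0 (f 0))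
    (hf1 : IsOfHodgeType E.dim E.X 1 0 1 (f 1)) {k p₀ q₀ : ℕ} (hk : 0 < k) (hpq : p₀ + q₀ = k)
    {c : complexBetti B.X k} (hc : IsOfHodgeType B.dim B.X k p₀ q₀ c) :
    ∃ a : (Fin k → Fin n × Fin 2) → ℂ,
      (∀ w, a w ≠ 0 → wordContent (colourWord w) 0 = p₀ ∧ wordContent (colourWord w) 1 = q₀) ∧
      wordEval (cupPowOneAlt ℂ (Motives.ComplexPoints B.X) k) (slotLetters g f) a = c := by
  classical
  set F := cupPowOneAlt ℂ (Motives.ComplexPoints B.X) k with hF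
  let W := {w : Fin k → Fin n × Fin 2 // wordContent (colourWord w) 0 = p₀ ∧ wordContent (colourWord w) 1 = q₀}
  set S : Submodule ℂ (complexBetti B.X k) :=
    Submodule.span ℂ (Set.range fun w : W => F (slotLetters g f ∘ (w : Fin k → Fin n × Fin 2))) with hS
  have hcS : c ∈ S := by
    refine AbelianVariety.mem_of_isOfHodgeType_of_typed_mem B hk hpq S ?_ c hc
    intro x p' q' h01 hx hp' hq'
    -- the colour of each factor
    let τ : Fin k → Fin 2 := fun i => if p' i = 1 then 0 else 1
    have hxi : ∀ i, x i ∈ Submodule.span ℂ (Set.range fun j : Fin n => slotLetters g f (j, τ i)) := by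
      intro i
      rcases h01 i with h | h
      · have hτ : τ i = 0 := by simp [τ, h.1]
        have hxi := hx i
        rw [h.1, h.2] at hxi
        rw [hτ]
        exact hg.mem_span_slotLetters_zero f hf0 hf1 hxi
      · have hτ : τ i = 1 := by simp [τ, h.1]
        have hxi := hx i
        rw [h.1, h.2] at hxi
        rw [hτ]
        exact hg.mem_span_slotLetters_one f hf0 hf1 hxi
    choose coef hcoef using fun i => (Submodule.mem_span_range_iff_exists_fun ℂ).1 (hxi i)
    have hx_eq : x = fun i => ∑ j, coef i j • slotLetters g f (j, τ i) := funext fun i => (hcoef i).symm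
    -- the colour word `τ` has content `(p₀, q₀)`
    have hτ0 : wordContent τ 0 = p₀ := by
      calc wordContent τ 0 = ∑ i, (if τ i = 0 then 1 else 0) := by
            rw [wordContent, Finset.card_eq_sum_ones, Finset.sum_filter]
        _ = ∑ i, p' i := Finset.sum_congr rfl fun i _ => by
            rcases h01 i with h | h <;> simp [τ, h.1]
        _ = p₀ := hp'
    have hτ1 : wordContent τ 1 = q₀ := by
      have hsum := sum_wordContent τ
      rw [Fin.sum_univ_two, hτ0] at hsum
      omega
    -- expand the monomial multilinearly
    have hexp : cupPowOne ℂ (Motives.ComplexPoints B.X) k x =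
        ∑ u : Fin k → Fin n, (∏ i, coef i (u i)) • F (fun i => slotLetters g f (u i, τ i)) := by
      rw [hx_eq, MultilinearMap.map_sum (cupPowOne ℂ (Motives.ComplexPoints B.X) k)
        (fun i j => coef i j • slotLetters g f (j, τ i))]
      refine Finset.sum_congr rfl fun u _ => ?_
      rw [MultilinearMap.map_smul_univ]
      rfl
    rw [hexp]
    refine Submodule.sum_mem _ fun u _ => Submodule.smul_mem _ _ ?_
    exact Submodule.subset_span ⟨⟨fun i => (u i, τ i), hτ0, hτ1⟩, rfl⟩
  obtain ⟨cf, hcf⟩ := (Submodule.mem_span_range_iff_exists_fun ℂ).1 hcS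
  refine ⟨fun w => if h : wordContent (colourWord w) 0 = p₀ ∧ wordContent (colourWord w) 1 = q₀ then cf ⟨w, h⟩ else 0,
    fun w hw => ?_, ?_⟩
  · by_contra h
    exact hw (dif_neg h)
  · rw [wordEval_apply, ← hcf]
    rw [← Finset.sum_subset (Finset.subset_univ (Finset.univ.filter fun w : Fin k → Fin n × Fin 2 =>
        wordContent (colourWord w) 0 = p₀ ∧ wordContent (colourWord w) 1 = q₀))]
    · rw [Finset.sum_subtype (Finset.univ.filter fun w : Fin k → Fin n × Fin 2 =>
          wordContent (colourWord w) 0 = p₀ ∧ wordContent (colourWord w) 1 = q₀)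
        (p := fun w => wordContent (colourWord w) 0 = p₀ ∧ wordContent (colourWord w) 1 = q₀)
        (fun w => by rw [Finset.mem_filter]; simp)]
      refine Finset.sum_congr rfl fun w _ => ?_
      rw [dif_pos w.2]
    · intro w _ hw
      rw [Finset.mem_filter] at hw
      have hw' : ¬ (wordContent (colourWord w) 0 = p₀ ∧ wordContent (colourWord w) 1 = q₀) := fun h => hw ⟨Finset.mem_univ _, h⟩
      rw [dif_neg hw', zero_smul]

end TypedWords

/-! ### §3 Normal forms of the monomial of a word (alternating maps) -/

section NormalForms

variable {M N : Type*} [AddCommGroup M] [Module ℂ M] [AddCommGroup N] [Module ℂ N] {L : Type*} {k : ℕ}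

/-- Two injective words with the same letters differ by a permutation of the positions (reordering a word; Fulton §8.1).
[cite: FultonYoungTableaux1997, §8.1] -/
theorem exists_perm_eq_comp_of_range_eq {w w₀ : Fin k → L} (hw : Function.Injective w)
    (h : Set.range w = Set.range w₀) : ∃ σ : Equiv.Perm (Fin k), w = w₀ ∘ σ := by
  have hmem : ∀ t, ∃ s, w₀ s = w t := fun t => by
    have ht : w t ∈ Set.range w₀ := h ▸ Set.mem_range_self t
    exact ht
  choose σ hσ using hmem
  have hinj : Function.Injective σ := by
    intro t t' htt'
    apply hw
    rw [← hσ t, ← hσ t', htt']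
  refine ⟨Equiv.ofBijective σ (Finite.injective_iff_bijective.1 hinj), funext fun t => ?_⟩
  rw [Function.comp_apply, Equiv.ofBijective_apply, hσ]

/-- The monomial of a permuted word is `sign` times the monomial (an alternating map), with the sign written as the complex
number `±1` (`e_{w∘σ} = ε_σ e_w` in `⋀`). [cite: Greub1978Multilinear, §5.7 (5.12)–(5.13)] [cite: FultonYoungTableaux1997, §8.1] -/
theorem map_comp_perm_eq_intCast_sign_smul (F : M [⋀^Fin k]→ₗ[ℂ] N) (v : Fin k → M) (σ : Equiv.Perm (Fin k)) :
    F (v ∘ σ) = (((Equiv.Perm.sign σ : ℤˣ) : ℤ) : ℂ) • F v := by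
  rw [AlternatingMap.map_perm, Units.smul_def, Int.cast_smul_eq_zsmul]

/-- The sign of a permutation, as an integer, is `1` or `-1`. [folklore] -/
private theorem sign_coe_eq_one_or (σ : Equiv.Perm (Fin k)) :
    ((Equiv.Perm.sign σ : ℤˣ) : ℤ) = 1 ∨ ((Equiv.Perm.sign σ : ℤˣ) : ℤ) = -1 := by
  rcases Int.units_eq_one_or (Equiv.Perm.sign σ) with h | h
  · exact Or.inl (by rw [h]; rfl)
  · exact Or.inr (by rw [h]; rfl)

/-- **Words with bijective slot map: the monomial is `±` the monomial of a COLOUR PATTERN in slot order.** For letters indexed by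
(slot, colour) `∈ Fin m × Fin 2` and a word `w` of length `m` whose slots `(w t).1` run through `Fin m` bijectively, with
`ε a =` the colour of the letter of `w` in slot `a`: `F(x ∘ w) = sign · F(a ↦ x (a, ε a))`. [cite: FultonYoungTableaux1997, §8.1] -/
theorem map_word_eq_sign_smul_of_bijective_fst {m : ℕ} (F : M [⋀^Fin m]→ₗ[ℂ] N) (x : Fin m × Fin 2 → M)
    (w : Fin m → Fin m × Fin 2) (hw : Function.Bijective fun t => (w t).1) :
    ∃ (σ : Equiv.Perm (Fin m)) (ε : Fin m → Fin 2), (∀ t, ε (w t).1 = (w t).2) ∧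
      F (x ∘ w) = (((Equiv.Perm.sign σ : ℤˣ) : ℤ) : ℂ) • F (fun a => x (a, ε a)) := by
  set σ := Equiv.ofBijective _ hw with hσ
  refine ⟨σ, fun a => (w (σ.symm a)).2, fun t => ?_, ?_⟩
  · have h : σ.symm (w t).1 = t := by
      have : σ t = (w t).1 := rfl
      rw [← this, Equiv.symm_apply_apply]
    show (w (σ.symm (w t).1)).2 = (w t).2
    rw [h]
  · have hcomp : x ∘ w = (fun a => x (a, (w (σ.symm a)).2)) ∘ σ := by
      funext t
      simp only [Function.comp_apply, Equiv.symm_apply_apply]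
      rfl
    rw [hcomp, map_comp_perm_eq_intCast_sign_smul]

/-- **Three-letter words with slot counts `(2, 1)` at `(a, b)`: the monomial is `0` or `±` the standard monomial
`F((a,0), (a,1), (b,r))`**, `r` the colour of the letter in slot `b` (if the two letters in slot `a` have the same colour the
word has a repeated letter and the alternating monomial vanishes; otherwise the word is a permutation of the standard one).
[cite: FultonYoungTableaux1997, §8.1] -/
theorem map_word_of_slotCounts_two_one {n : ℕ} (F : M [⋀^Fin 3]→ₗ[ℂ] N) (x : Fin n × Fin 2 → M)
    (w : Fin 3 → Fin n × Fin 2) {a b : Fin n} (hab : a ≠ b)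
    (ha : (Finset.univ.filter fun t => (w t).1 = a).card = 2) (hb : (Finset.univ.filter fun t => (w t).1 = b).card = 1) :
    ∃ (t : Fin 3) (ε : ℤ), (w t).1 = b ∧ (ε = 0 ∨ ε = 1 ∨ ε = -1) ∧
      F (x ∘ w) = (ε : ℂ) • F ![x (a, 0), x (a, 1), x (b, (w t).2)] := by
  classical
  obtain ⟨tb, htb⟩ := Finset.card_eq_one.1 hb
  obtain ⟨t₁, t₂, h12, hta⟩ := Finset.card_eq_two.1 ha
  have hb' : (w tb).1 = b := by
    have h : tb ∈ Finset.univ.filter fun t => (w t).1 = b := by rw [htb]; exact Finset.mem_singleton_self _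
    exact (Finset.mem_filter.1 h).2
  have h1a : (w t₁).1 = a := by
    have h : t₁ ∈ Finset.univ.filter fun t => (w t).1 = a := by rw [hta]; simp
    exact (Finset.mem_filter.1 h).2
  have h2a : (w t₂).1 = a := by
    have h : t₂ ∈ Finset.univ.filter fun t => (w t).1 = a := by rw [hta]; simp
    exact (Finset.mem_filter.1 h).2
  have hb1 : tb ≠ t₁ := fun h => hab (by rw [← h1a, ← h, hb'])
  have hb2 : tb ≠ t₂ := fun h => hab (by rw [← h2a, ← h, hb'])
  -- every position is `tb`, `t₁` or `t₂`
  have huniv : ∀ t : Fin 3, t = tb ∨ t = t₁ ∨ t = t₂ := by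
    have hcard : ({tb, t₁, t₂} : Finset (Fin 3)) = Finset.univ := by
      apply Finset.eq_univ_of_card
      rw [Finset.card_insert_of_notMem (by simp [hb1, hb2]), Finset.card_pair h12, Fintype.card_fin]
    intro t
    have ht : t ∈ ({tb, t₁, t₂} : Finset (Fin 3)) := by rw [hcard]; exact Finset.mem_univ t
    simpa using ht
  refine ⟨tb, ?_⟩
  by_cases hc : (w t₁).2 = (w t₂).2
  · -- repeated letter
    refine ⟨0, hb', Or.inl rfl, ?_⟩
    have hrep : (x ∘ w) t₁ = (x ∘ w) t₂ := by
      simp only [Function.comp_apply]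
      rw [show w t₁ = w t₂ from Prod.ext (h1a.trans h2a.symm) hc]
    rw [F.map_eq_zero_of_eq (x ∘ w) hrep h12, Int.cast_zero, zero_smul]
  · -- a permutation of the standard word
    set w₀ : Fin 3 → Fin n × Fin 2 := ![(a, 0), (a, 1), (b, (w tb).2)] with hw₀
    have h3 : ∀ i : Fin 3, i = 0 ∨ i = 1 ∨ i = 2 := by
      intro i; fin_cases i <;> simp
    have hv0 : w₀ 0 = (a, 0) := rfl
    have hv1 : w₀ 1 = (a, 1) := rfl
    have hv2 : w₀ 2 = (b, (w tb).2) := rfl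
    have h01 : (0 : Fin 2) ≠ 1 := by decide
    have hw₀inj : Function.Injective w₀ := by
      intro i j hij
      rcases h3 i with rfl | rfl | rfl <;> rcases h3 j with rfl | rfl | rfl
      · rfl
      · exact absurd (Prod.mk_inj.1 (hv0.symm.trans (hij.trans hv1))).2 h01
      · exact absurd (Prod.mk_inj.1 (hv0.symm.trans (hij.trans hv2))).1 hab
      · exact absurd (Prod.mk_inj.1 (hv1.symm.trans (hij.trans hv0))).2 h01.symm
      · rfl
      · exact absurd (Prod.mk_inj.1 (hv1.symm.trans (hij.trans hv2))).1 hab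
      · exact absurd (Prod.mk_inj.1 (hv2.symm.trans (hij.trans hv0))).1 (Ne.symm hab)
      · exact absurd (Prod.mk_inj.1 (hv2.symm.trans (hij.trans hv1))).1 (Ne.symm hab)
      · rfl
    have hwinj : Function.Injective w := by
      intro i j hij
      rcases huniv i with hi | hi | hi <;> rcases huniv j with hj | hj | hj <;> rw [hi, hj] at hij
      · exact hi.trans hj.symm
      · exact absurd (h1a.symm.trans ((congrArg Prod.fst hij).symm.trans hb')) hab
      · exact absurd (h2a.symm.trans ((congrArg Prod.fst hij).symm.trans hb')) hab
      · exact absurd (h1a.symm.trans ((congrArg Prod.fst hij).trans hb')) hab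
      · exact hi.trans hj.symm
      · exact absurd (congrArg Prod.snd hij) hc
      · exact absurd (h2a.symm.trans ((congrArg Prod.fst hij).trans hb')) hab
      · exact absurd (congrArg Prod.snd hij).symm hc
      · exact hi.trans hj.symm
    have hsub : Set.range w ⊆ Set.range w₀ := by
      rintro _ ⟨t, rfl⟩
      rcases huniv t with ht | ht | ht <;> rw [ht]
      · exact ⟨2, by rw [hv2, ← hb']⟩
      · rcases Fin.exists_fin_two.1 ⟨(w t₁).2, rfl⟩ with h0 | h0
        · exact ⟨0, by rw [hv0, ← h1a, ← h0]⟩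
        · exact ⟨1, by rw [hv1, ← h1a, ← h0]⟩
      · rcases Fin.exists_fin_two.1 ⟨(w t₂).2, rfl⟩ with h0 | h0
        · exact ⟨0, by rw [hv0, ← h2a, ← h0]⟩
        · exact ⟨1, by rw [hv1, ← h2a, ← h0]⟩
    have hrange : Set.range w = Set.range w₀ := by
      have hfin : (Set.range w₀).toFinset.card ≤ (Set.range w).toFinset.card := by
        rw [Set.toFinset_range, Set.toFinset_range, Finset.card_image_of_injective _ hw₀inj,
          Finset.card_image_of_injective _ hwinj]
      have hsub' : (Set.range w).toFinset ⊆ (Set.range w₀).toFinset := Set.toFinset_mono hsub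
      have heq := Finset.eq_of_subset_of_card_le hsub' hfin
      have := congrArg (fun s : Finset (Fin n × Fin 2) => (s : Set (Fin n × Fin 2))) heq
      simpa using this
    obtain ⟨σ, hσ⟩ := exists_perm_eq_comp_of_range_eq hwinj hrange
    refine ⟨((Equiv.Perm.sign σ : ℤˣ) : ℤ), hb', Or.inr (sign_coe_eq_one_or σ), ?_⟩
    have hxw : x ∘ w = (x ∘ w₀) ∘ σ := by rw [hσ]; rfl
    rw [hxw, map_comp_perm_eq_intCast_sign_smul]
    congr 1
    congr 1
    funext i
    fin_cases i <;> rfl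

/-- The three-letter cup monomial is the iterated cup product `x₀ ⌣ (x₁ ⌣ x₂)`. [cite: HatcherAT2002, §3.2 Prop. 3.10] -/
theorem cupPowOneAlt_three {Y : Type} [TopologicalSpace Y] (x₀ x₁ x₂ : singularCohomology ℂ ℂ Y 1) :
    cupPowOneAlt ℂ Y 3 ![x₀, x₁, x₂] =
      cupProduct (show 1 + 2 = 3 by norm_num) x₀ (cupProduct (show 1 + 1 = 2 by norm_num) x₁ x₂) := by
  rw [cupPowOneAlt_apply]
  change cupPowOne ℂ Y (1 + 1 + 1) ![x₀, x₁, x₂] = _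
  rw [cupPowOne_succ, cupPowOne_succ, cupPowOne_one]
  rfl

/-- The three-letter cup monomial, bracketed to the left: `(x₀ ⌣ x₁) ⌣ x₂`. [cite: HatcherAT2002, §3.2 Prop. 3.10] -/
theorem cupPowOneAlt_three' {Y : Type} [TopologicalSpace Y] (x₀ x₁ x₂ : singularCohomology ℂ ℂ Y 1) :
    cupPowOneAlt ℂ Y 3 ![x₀, x₁, x₂] =
      cupProduct (show 2 + 1 = 3 by norm_num) (cupProduct (show 1 + 1 = 2 by norm_num) x₀ x₁) x₂ := by
  rw [cupPowOneAlt_three, cupProduct_assoc (show 1 + 1 = 2 by norm_num) (show 1 + 1 = 2 by norm_num)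
    (show 2 + 1 = 3 by norm_num) (show 1 + 2 = 3 by norm_num)]

end NormalForms

/-! ### §4 Shears of `E³` and their action on the letters -/

section Shears

variable {E : AbelianVariety ℂ}

/-- The slot projections of `E³ = E.powSucc 2 = (E × E) × E` are `pr₁₂ ≫ pr₁`, `pr₁₂ ≫ pr₂`, `pr₃`. [cite: Gordon1997, §3] -/
theorem EllipticCurve.powSlots_two_eq (i : Fin 3) :
    powSlots E 2 i = (![Motives.AbelianVariety.fst (E.prod E) E ≫ Motives.AbelianVariety.fst E E,
      Motives.AbelianVariety.fst (E.prod E) E ≫ Motives.AbelianVariety.snd E E,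
      Motives.AbelianVariety.snd (E.prod E) E] : Fin 3 → (E.powSucc 2 ⟶ E)) i := by
  fin_cases i
  · change Motives.AbelianVariety.fst (E.prod E) E ≫ (Motives.AbelianVariety.fst E E ≫ 𝟙 E) = _
    rw [Category.comp_id]; rfl
  · change Motives.AbelianVariety.fst (E.prod E) E ≫ (Motives.AbelianVariety.snd E E ≫ 𝟙 E) = _
    rw [Category.comp_id]; rfl
  · change Motives.AbelianVariety.snd (E.prod E) E ≫ 𝟙 E = _
    rw [Category.comp_id]; rfl

/-- A homomorphism into `E³` with prescribed slot components (`(h₀, h₁, h₂) : T → (E × E) × E`, the universal property of the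
product abelian variety). [cite: LangeBirkenhake1992, §1.1 (p. 19)] [cite: Gordon1997, §3] -/
theorem EllipticCurve.exists_hom_powThree_comp_powSlots {T : AbelianVariety ℂ} (h : Fin 3 → (T ⟶ E)) :
    ∃ u : T ⟶ E.powSucc 2, ∀ i, u ≫ powSlots E 2 i = h i := by
  refine ⟨Motives.AbelianVariety.prodLift (Motives.AbelianVariety.prodLift (h 0) (h 1)) (h 2), fun i => ?_⟩
  rw [EllipticCurve.powSlots_two_eq]
  fin_cases i
  · change Motives.AbelianVariety.prodLift _ _ ≫ Motives.AbelianVariety.fst (E.prod E) E ≫ Motives.AbelianVariety.fst E E = h 0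
    exact (Motives.AbelianVariety.prodLift_fst_assoc _ _ _).trans (Motives.AbelianVariety.prodLift_fst _ _)
  · change Motives.AbelianVariety.prodLift _ _ ≫ Motives.AbelianVariety.fst (E.prod E) E ≫ Motives.AbelianVariety.snd E E = h 1
    exact (Motives.AbelianVariety.prodLift_fst_assoc _ _ _).trans (Motives.AbelianVariety.prodLift_snd _ _)
  · change Motives.AbelianVariety.prodLift _ _ ≫ Motives.AbelianVariety.snd (E.prod E) E = h 2
    exact Motives.AbelianVariety.prodLift_snd _ _

/-- **The shear `x_a ↦ x_a + ψ(x_c)` of `E³`** (`a`, `c` any slots, `ψ : E → E`): an endomorphism `u` of `E³ = E.powSucc 2` with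
`u ≫ q_a = q_a + q_c ≫ ψ` and `u ≫ q_i = q_i` for `i ≠ a`. [cite: MoonenZarhin1999LowDim, §5] [cite: LangeBirkenhake1992, §5] -/
theorem EllipticCurve.exists_powThree_shear (a c : Fin 3) (ψ : E ⟶ E) :
    ∃ u : E.powSucc 2 ⟶ E.powSucc 2, u ≫ powSlots E 2 a = powSlots E 2 a + powSlots E 2 c ≫ ψ ∧
      ∀ i, i ≠ a → u ≫ powSlots E 2 i = powSlots E 2 i := by
  classical
  obtain ⟨u, hu⟩ := EllipticCurve.exists_hom_powThree_comp_powSlots (E := E)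
    (fun i => if i = a then powSlots E 2 a + powSlots E 2 c ≫ ψ else powSlots E 2 i)
  refine ⟨u, ?_, fun i hi => ?_⟩
  · rw [hu, if_pos rfl]
  · rw [hu, if_neg hi]

/-- **Action of the shear on the letters**: `u^*(g_a^* v) = g_a^* v + g_c^*(ψ^* v)` and `u^*(g_i^* v) = g_i^* v` (`i ≠ a`)
(pull-back along homomorphisms is additive on `H¹`). [cite: LangeBirkenhake1992, §1.1 (p. 19)] [cite: HatcherAT2002, §3.2 Prop. 3.10] -/
theorem EllipticCurve.powThree_shear_slotLetters {a c : Fin 3} {ψ : E ⟶ E} {u : E.powSucc 2 ⟶ E.powSucc 2}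
    (hua : u ≫ powSlots E 2 a = powSlots E 2 a + powSlots E 2 c ≫ ψ) (hui : ∀ i, i ≠ a → u ≫ powSlots E 2 i = powSlots E 2 i)
    (v : Fin 2 → complexBetti E.X 1) (i : Fin 3) (r : Fin 2) :
    complexBetti.map u.hom.hom.hom 1 (slotLetters (powSlots E 2) v (i, r)) =
      if i = a then slotLetters (powSlots E 2) v (a, r) + complexBetti.map (powSlots E 2 c).hom.hom.hom 1
        (complexBetti.map ψ.hom.hom.hom 1 (v r)) else slotLetters (powSlots E 2) v (i, r) := by
  simp only [slotLetters_apply]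
  rw [abelianVarietyHom_map_map_apply]
  split_ifs with hi
  · subst hi
    rw [hua, complexBetti_map_add_deg_one, ← abelianVarietyHom_map_map_apply]
  · rw [hui i hi]

end Shears

/-! ### §5 Complex multiplication: the single crossed class `g_i^* ω ⌣ g_j^* ω̄` is a combination of rational `(1,1)`-classes -/

section Crosses

variable {E B : AbelianVariety ℂ} {n : ℕ}

/-- **For `E` with complex multiplication (`¬ HodgeEndTrivial E`), every single cross `g_i^*ω ⌣ g_j^*ω̄` (`ω` a generator of
`H^{1,0}(E)`, `ω̄` its conjugate) lies in `D¹(B) ⊗ ℂ`**, the `ℂ`-span of the rational `(1,1)`-classes of `B` — pull-back of the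
tree's `EllipticCurve.cross_mem_span_rational_oneOne_of_not_hodgeEndTrivial` (the two crosses on `E × E`) along
`(g_i, g_j) : B → E × E`. For `i = j` this is `g_i^*(ω ⌣ ω̄)`, for `i ≠ j` the graph-type classes of the complex multiplications.
[cite: LangeBirkenhake1992, §5 (Néron–Severi of E × E)] [cite: Gordon1997, §3] [cite: MoonenZarhin1999LowDim, §2 (2.1) Type IV(1,1)] -/
theorem EllipticCurve.slotLetters_cross_mem_span_rational_oneOne_of_not_hodgeEndTrivial (hE : E.dim = 1)
    (hT : ¬ EllipticCurve.HodgeEndTrivial E) (g : Fin n → (B ⟶ E))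
    (f : Module.Basis (Fin 2) ℂ (complexBetti E.X 1)) (hf0 : IsOfHodgeType E.dim E.X 1 1 0 (f 0))
    (hgen : ∀ u, IsOfHodgeType E.dim E.X 1 1 0 u → ∃ z : ℂ, u = z • f 0)
    (hf1 : f 1 = conjClass (Motives.ComplexPoints E.X) 1 (f 0)) (i j : Fin n) :
    cupProduct (rfl : 1 + 1 = 2) (slotLetters g f (i, 0)) (slotLetters g f (j, 1)) ∈
      Submodule.span ℂ {b : complexBetti B.X 2 | IsRationalClass b ∧ IsOfHodgeType B.dim B.X 2 1 1 b} := by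
  have hB : IsSmoothProjective B.dim B.X := Motives.AbelianVariety.isSmoothProjective_holds
  have hEE : IsSmoothProjective (E.prod E).dim (E.prod E).X := Motives.AbelianVariety.isSmoothProjective_holds
  have hcross := (EllipticCurve.cross_mem_span_rational_oneOne_of_not_hodgeEndTrivial hE hT hf0 (f.ne_zero 0) hgen).1
  rw [← hf1] at hcross
  set π : B ⟶ E.prod E := Motives.AbelianVariety.prodLift (g i) (g j) with hπ
  have hpull := map_mem_span_rational_oneOne hB hEE π.hom.hom.hom hcross
  rw [complexBetti.map_cupProduct, abelianVarietyHom_map_map_apply, abelianVarietyHom_map_map_apply,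
    hπ, Motives.AbelianVariety.prodLift_fst, Motives.AbelianVariety.prodLift_snd] at hpull
  simpa only [slotLetters_apply] using hpull

/-- **Every class of `H²(B)` pulled back from `H²(E)` along a slot lies in `D¹(B) ⊗ ℂ`** (`H²(E) = D¹(E) ⊗ ℂ`: the point class).
[cite: LangeBirkenhake1992, §5] [cite: VoisinHodgeI2002, §11.3.2] -/
theorem EllipticCurve.map_slot_two_mem_span_rational_oneOne (hE : E.dim = 1) (q : B ⟶ E) (θ : complexBetti E.X 2) :
    complexBetti.map q.hom.hom.hom 2 θ ∈
      Submodule.span ℂ {b : complexBetti B.X 2 | IsRationalClass b ∧ IsOfHodgeType B.dim B.X 2 1 1 b} :=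
  map_mem_span_rational_oneOne (Motives.AbelianVariety.isSmoothProjective_holds (A := B))
    (Motives.AbelianVariety.isSmoothProjective_holds (A := E)) _ (EllipticCurve.mem_span_rational_oneOne hE θ)

end Crosses

end Literature.AlgebraicGeometry.HodgeTheory

end
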